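import Summits.Ventures.LatticeQCDFlow.Exactness.IMHColdStartPathMixture
import HarnessLib

/-!
# The cold start at every order: the `k`-time recursion and the exact three-time law of flow-MCMC started at a mode

HONEST FRAMING: exact (Metropolis-corrected) sampling algorithms for lattice gauge theory;
figures of merit are autocorrelation/cost numbers at stated couplings and volumes; no
continuum-physics claim.

Venture `LatticeQCDFlow` (cell pub-lqcd), topic `Exactness`; FANOUT row 30 (lean-1, GEN-33).  NEW WORK of the
cell, general state space.  `K = indepMH q w`, `x₀` a mode of the normalised weight `w`, `A = 1/w(x₀)`, `r = 1 − A`,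
`P_μ` the chain law on path space, `θ_s x = x(s + ·)` the shift.  GEN-31: one-time laws; GEN-32
(`IMHColdStartTwoTime`): two-time laws, "NOT CLAIMED: three-time laws".  With the path mixture law of
`IMHColdStartPathMixture` (`P_{x₀} ∘ θ_s⁻¹ = (1 − r^s)P_π + r^s P_{x₀}`) every `k`-time law is one line:

* §1 bookkeeping: **`imh_chain_stationary_shift`** — the equilibrium run is shift-invariant as a law on path space
  (`P_π ∘ θ_s⁻¹ = P_π`; integral form **`imh_chain_stationary_shift_integral`**); **`chain_dirac_integral_eval_zero_mul`**
  — under `P_{x₀}` the time-`0` factor comes out: `E_{x₀}[f(X_0)·F(X)] = f(x₀)·E_{x₀}[F(X)]` (any Markov kernel).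
* §2 **`imh_chain_mul_shift_mode`** — THE `k`-TIME RECURSION: for bounded measurable `f` on states and `F` on paths,
  `E_{x₀}[f(X_s)·F(θ_s X)] = (1 − r^s)·E_π[f(X_0)·F(X)] + r^s·f(x₀)·E_{x₀}[F(X)]` — peel the earliest time: either
  the run has thawed by then (equilibrium from there on) or it is still frozen (the factor `f(x₀)` comes out and the
  rest is a cold-started run again); **`imh_chain_mul_shift_mode_sub_stationary`** —
  `E_{x₀}[f(X_s)F(θ_s X)] − E_π[f(X_s)F(θ_s X)] = r^s·(f(x₀)·E_{x₀}[F] − E_π[f(X_0)·F])`: EVERY MULTI-TIME STATISTIC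
  FORGETS THE COLD START AT THE EXACT RATE `r^s` IN ITS EARLIEST INDEX (GEN-32 proved the case `F = g(X_u)`).
* §3 **`imh_chain_threeTime_mode`** — THE EXACT THREE-TIME LAW: for bounded measurable `f, g, h` and all `s, u, v`,
  `E_{x₀}[f(X_s)g(X_{s+u})h(X_{s+u+v})] = (1 − r^s)·E_π[f(X_0)g(X_u)h(X_{u+v})]
     + r^s f(x₀)·[(1 − r^u)·∫ g·(K^v h) dπ + r^u g(x₀)·((1 − r^v)·π h + r^v h(x₀))]`;
  centred form **`imh_chain_threeTime_mode_of_centred`** (`π h = 0`): the frozen contributions are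
  `r^s(1 − r^u) f(x₀)∫ g·K^v h dπ` and the TRIPLY FROZEN term `r^{s+u+v} f(x₀)g(x₀)h(x₀)`; against the equilibrium run
  **`imh_chain_threeTime_mode_sub_stationary`**.

Reading (gauge files `Scaling/AutoregressiveGauge…MultiTime`): for cold-started exact gauge samplers every `k`-point
function in simulation time differs from its equilibrium value by `(1 − A)^s` times an explicit bracket, `s` the
earliest time involved.  NOT CLAIMED: closed forms for the equilibrium `k`-time moments themselves
(`E_π[f(X_0)g(X_u)h(X_{u+v})]` is what it is); non-modal starts.

No `sorry`, no new definitions, nothing cited as a fact; general measurable space with measurable singletons.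
-/

noncomputable section

namespace Summit.Ventures.LatticeQCDFlow.Exactness

open MeasureTheory ProbabilityTheory Function Finset
open scoped ENNReal
open Summit.Ventures.LatticeQCDFlow.Scoring

variable {Ω : Type*} [MeasurableSpace Ω]

/-! ## §1 Bookkeeping -/

/-- **Under `P_{x₀}` the time-`0` factor comes out**: `E_{x₀}[f(X_0)·F(X)] = f(x₀)·E_{x₀}[F(X)]` for every Markov
kernel, measurable `f` and path statistic `F`. [ours, bookkeeping] -/
theorem chain_dirac_integral_eval_zero_mul [MeasurableSingletonClass Ω] (κ : Kernel Ω Ω) [IsMarkovKernel κ] (x₀ : Ω)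
    (f : Ω → ℝ) (F : (ℕ → Ω) → ℝ) :
    ∫ x, f (x 0) * F x ∂(Kernel.trajMeasure (X := fun _ : ℕ => Ω) (Measure.dirac x₀)
        (fun n : ℕ => κ.comap (fun h : (i : ↥(Finset.Iic n)) → Ω => h ⟨n, Finset.mem_Iic.2 le_rfl⟩)
          (measurable_pi_apply _))) =
      f x₀ * ∫ x, F x ∂(Kernel.trajMeasure (X := fun _ : ℕ => Ω) (Measure.dirac x₀)
        (fun n : ℕ => κ.comap (fun h : (i : ↥(Finset.Iic n)) → Ω => h ⟨n, Finset.mem_Iic.2 le_rfl⟩)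
          (measurable_pi_apply _))) := by
  set P := Kernel.trajMeasure (X := fun _ : ℕ => Ω) (Measure.dirac x₀)
      (fun n : ℕ => κ.comap (fun h : (i : ↥(Finset.Iic n)) → Ω => h ⟨n, Finset.mem_Iic.2 le_rfl⟩)
        (measurable_pi_apply _)) with hP
  have h0 : ∀ᵐ x ∂P, x 0 = x₀ := by
    have h1 : P.map (fun x : ℕ → Ω => x 0) = Measure.dirac x₀ := by
      rw [hP]; exact chain_map_eval_zero κ (Measure.dirac x₀)
    have h2 : ∀ᵐ z ∂(P.map (fun x : ℕ → Ω => x 0)), z ∈ ({x₀} : Set Ω) := by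
      rw [h1]; exact (ae_dirac_iff (measurableSet_singleton x₀)).2 rfl
    exact ae_of_ae_map (measurable_pi_apply 0).aemeasurable h2
  rw [← integral_const_mul]
  refine integral_congr_ae ?_
  filter_upwards [h0] with x hx
  rw [hx]

variable [MeasurableSingletonClass Ω] {q : Measure Ω} [IsProbabilityMeasure q] {w : Ω → ℝ}

omit [MeasurableSingletonClass Ω] in
/-- Iterating the chain on its invariant law: `πK^s = π`. [ours, bookkeeping] -/
theorem iterate_bind_indepMH_invariant (hw : Measurable w) (hw0 : ∀ y, 0 < w y)
    [IsProbabilityMeasure (q.withDensity fun y => ENNReal.ofReal (w y))] (s : ℕ) :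
    (fun m : Measure Ω => m.bind (indepMH q w))^[s] (q.withDensity fun y => ENNReal.ofReal (w y)) =
      q.withDensity fun y => ENNReal.ofReal (w y) := by
  induction s with
  | zero => rfl
  | succ s ih =>
    haveI : Fact (Measurable w) := ⟨hw⟩
    rw [Function.iterate_succ_apply', ih]
    exact (indepMH_invariant (q := q) hw hw0).def

omit [MeasurableSingletonClass Ω] in
/-- **The equilibrium run is shift-invariant as a law on path space**: `P_π ∘ θ_s⁻¹ = P_π`. [ours, bookkeeping] -/
theorem imh_chain_stationary_shift [Fact (Measurable w)] (hw0 : ∀ y, 0 < w y)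
    [IsProbabilityMeasure (q.withDensity fun y => ENNReal.ofReal (w y))] (s : ℕ) :
    (Kernel.trajMeasure (X := fun _ : ℕ => Ω) (q.withDensity fun y => ENNReal.ofReal (w y))
        (fun n : ℕ => (indepMH q w).comap (fun h : (i : ↥(Finset.Iic n)) → Ω => h ⟨n, Finset.mem_Iic.2 le_rfl⟩)
          (measurable_pi_apply _))).map (fun (x : ℕ → Ω) (n : ℕ) => x (s + n)) =
      Kernel.trajMeasure (X := fun _ : ℕ => Ω) (q.withDensity fun y => ENNReal.ofReal (w y))
        (fun n : ℕ => (indepMH q w).comap (fun h : (i : ↥(Finset.Iic n)) → Ω => h ⟨n, Finset.mem_Iic.2 le_rfl⟩)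
          (measurable_pi_apply _)) := by
  rw [chain_map_shift_eq (indepMH q w) _ s, iterate_bind_indepMH_invariant Fact.out hw0 s]

omit [MeasurableSingletonClass Ω] in
/-- Integral form: `E_π[F(θ_s X)] = E_π[F(X)]` for every bounded measurable path statistic. [ours, bookkeeping] -/
theorem imh_chain_stationary_shift_integral [Fact (Measurable w)] (hw0 : ∀ y, 0 < w y)
    [IsProbabilityMeasure (q.withDensity fun y => ENNReal.ofReal (w y))] {F : (ℕ → Ω) → ℝ} (hF : Measurable F)
    (s : ℕ) :
    ∫ x, F (fun n => x (s + n)) ∂(Kernel.trajMeasure (X := fun _ : ℕ => Ω)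
        (q.withDensity fun y => ENNReal.ofReal (w y))
        (fun n : ℕ => (indepMH q w).comap (fun h : (i : ↥(Finset.Iic n)) → Ω => h ⟨n, Finset.mem_Iic.2 le_rfl⟩)
          (measurable_pi_apply _))) =
      ∫ x, F x ∂(Kernel.trajMeasure (X := fun _ : ℕ => Ω) (q.withDensity fun y => ENNReal.ofReal (w y))
        (fun n : ℕ => (indepMH q w).comap (fun h : (i : ↥(Finset.Iic n)) → Ω => h ⟨n, Finset.mem_Iic.2 le_rfl⟩)
          (measurable_pi_apply _))) := by
  have hΘ : Measurable (fun (x : ℕ → Ω) (n : ℕ) => x (s + n)) :=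
    measurable_pi_lambda _ fun n => measurable_pi_apply _
  rw [← integral_map hΘ.aemeasurable hF.aestronglyMeasurable, imh_chain_stationary_shift hw0 s]

omit [MeasurableSpace Ω] [MeasurableSingletonClass Ω] in
/-- A state observable times a path statistic is a bounded measurable path statistic. [ours, bookkeeping] -/
theorem measurable_eval_zero_mul [MeasurableSpace Ω] {f : Ω → ℝ} (hf : Measurable f) {Cf : ℝ} (hCf : ∀ x, |f x| ≤ Cf)
    {F : (ℕ → Ω) → ℝ} (hF : Measurable F) {C : ℝ} (hC : ∀ x, |F x| ≤ C) :
    Measurable (fun x : ℕ → Ω => f (x 0) * F x) ∧ ∀ x : ℕ → Ω, |f (x 0) * F x| ≤ Cf * C := by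
  refine ⟨(hf.comp (measurable_pi_apply 0)).mul hF, fun x => ?_⟩
  rw [abs_mul]
  exact mul_le_mul (hCf _) (hC x) (abs_nonneg _) ((abs_nonneg _).trans (hCf (x 0)))

/-! ## §2 The `k`-time recursion -/

/-- **THE `k`-TIME RECURSION.**  `w` measurable (a `Fact`), positive, normalised, maximal at `x₀`; `f` bounded
measurable on states, `F` bounded measurable on paths; `r = 1 − 1/w(x₀)`.  For every `s`:
`E_{x₀}[f(X_s)·F(θ_s X)] = (1 − r^s)·E_π[f(X_0)·F(X)] + r^s·f(x₀)·E_{x₀}[F(X)]`. [ours] -/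
theorem imh_chain_mul_shift_mode [Fact (Measurable w)] (hw0 : ∀ y, 0 < w y) {x₀ : Ω} (hmax : ∀ y, w y ≤ w x₀)
    [IsProbabilityMeasure (q.withDensity fun y => ENNReal.ofReal (w y))]
    {f : Ω → ℝ} (hf : Measurable f) {Cf : ℝ} (hCf : ∀ x, |f x| ≤ Cf)
    {F : (ℕ → Ω) → ℝ} (hF : Measurable F) {C : ℝ} (hC : ∀ x, |F x| ≤ C) (s : ℕ) :
    ∫ x, f (x s) * F (fun n => x (s + n)) ∂(Kernel.trajMeasure (X := fun _ : ℕ => Ω) (Measure.dirac x₀)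
        (fun n : ℕ => (indepMH q w).comap (fun h : (i : ↥(Finset.Iic n)) → Ω => h ⟨n, Finset.mem_Iic.2 le_rfl⟩)
          (measurable_pi_apply _))) =
      (1 - (1 - (w x₀)⁻¹) ^ s) *
          ∫ x, f (x 0) * F x ∂(Kernel.trajMeasure (X := fun _ : ℕ => Ω)
            (q.withDensity fun y => ENNReal.ofReal (w y))
            (fun n : ℕ => (indepMH q w).comap (fun h : (i : ↥(Finset.Iic n)) → Ω => h ⟨n, Finset.mem_Iic.2 le_rfl⟩)
              (measurable_pi_apply _))) +
        (1 - (w x₀)⁻¹) ^ s * (f x₀ *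
          ∫ x, F x ∂(Kernel.trajMeasure (X := fun _ : ℕ => Ω) (Measure.dirac x₀)
            (fun n : ℕ => (indepMH q w).comap (fun h : (i : ↥(Finset.Iic n)) → Ω => h ⟨n, Finset.mem_Iic.2 le_rfl⟩)
              (measurable_pi_apply _)))) := by
  obtain ⟨hHm, hHb⟩ := measurable_eval_zero_mul hf hCf hF hC
  have h := imh_chain_shift_integral_mode (q := q) hw0 hmax (F := fun x : ℕ → Ω => f (x 0) * F x) hHm hHb s
    (x₀ := x₀)
  simp only [Nat.add_zero] at h
  rw [h, chain_dirac_integral_eval_zero_mul (indepMH q w) x₀ f F]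

/-- **EVERY MULTI-TIME STATISTIC FORGETS THE COLD START AT THE EXACT RATE `r^s` IN ITS EARLIEST INDEX**:
`E_{x₀}[f(X_s)F(θ_s X)] − E_π[f(X_s)F(θ_s X)] = r^s·(f(x₀)·E_{x₀}[F] − E_π[f(X_0)·F])`. [ours] -/
theorem imh_chain_mul_shift_mode_sub_stationary [Fact (Measurable w)] (hw0 : ∀ y, 0 < w y) {x₀ : Ω}
    (hmax : ∀ y, w y ≤ w x₀) [IsProbabilityMeasure (q.withDensity fun y => ENNReal.ofReal (w y))]
    {f : Ω → ℝ} (hf : Measurable f) {Cf : ℝ} (hCf : ∀ x, |f x| ≤ Cf)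
    {F : (ℕ → Ω) → ℝ} (hF : Measurable F) {C : ℝ} (hC : ∀ x, |F x| ≤ C) (s : ℕ) :
    ∫ x, f (x s) * F (fun n => x (s + n)) ∂(Kernel.trajMeasure (X := fun _ : ℕ => Ω) (Measure.dirac x₀)
        (fun n : ℕ => (indepMH q w).comap (fun h : (i : ↥(Finset.Iic n)) → Ω => h ⟨n, Finset.mem_Iic.2 le_rfl⟩)
          (measurable_pi_apply _))) -
      ∫ x, f (x s) * F (fun n => x (s + n)) ∂(Kernel.trajMeasure (X := fun _ : ℕ => Ω)
        (q.withDensity fun y => ENNReal.ofReal (w y))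
        (fun n : ℕ => (indepMH q w).comap (fun h : (i : ↥(Finset.Iic n)) → Ω => h ⟨n, Finset.mem_Iic.2 le_rfl⟩)
          (measurable_pi_apply _))) =
      (1 - (w x₀)⁻¹) ^ s *
        (f x₀ * ∫ x, F x ∂(Kernel.trajMeasure (X := fun _ : ℕ => Ω) (Measure.dirac x₀)
            (fun n : ℕ => (indepMH q w).comap (fun h : (i : ↥(Finset.Iic n)) → Ω => h ⟨n, Finset.mem_Iic.2 le_rfl⟩)
              (measurable_pi_apply _))) -
          ∫ x, f (x 0) * F x ∂(Kernel.trajMeasure (X := fun _ : ℕ => Ω)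
            (q.withDensity fun y => ENNReal.ofReal (w y))
            (fun n : ℕ => (indepMH q w).comap (fun h : (i : ↥(Finset.Iic n)) → Ω => h ⟨n, Finset.mem_Iic.2 le_rfl⟩)
              (measurable_pi_apply _)))) := by
  obtain ⟨hHm, -⟩ := measurable_eval_zero_mul hf hCf hF hC
  have hst := imh_chain_stationary_shift_integral (q := q) hw0 (F := fun x : ℕ → Ω => f (x 0) * F x) hHm s
  simp only [Nat.add_zero] at hst
  rw [imh_chain_mul_shift_mode hw0 hmax hf hCf hF hC s, hst]
  ring

/-! ## §3 The exact three-time law -/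

omit [MeasurableSingletonClass Ω] [IsProbabilityMeasure q] in
/-- The two-time path statistic `y ↦ g(y_u)·h(y_{u+v})` is bounded measurable. [ours, bookkeeping] -/
theorem measurable_twoTime_statistic {g h : Ω → ℝ} (hg : Measurable g) {Cg : ℝ} (hCg : ∀ x, |g x| ≤ Cg)
    (hh : Measurable h) {Ch : ℝ} (hCh : ∀ x, |h x| ≤ Ch) (u v : ℕ) :
    Measurable (fun y : ℕ → Ω => g (y u) * h (y (u + v))) ∧ ∀ y : ℕ → Ω, |g (y u) * h (y (u + v))| ≤ Cg * Ch := by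
  refine ⟨(hg.comp (measurable_pi_apply u)).mul (hh.comp (measurable_pi_apply (u + v))), fun y => ?_⟩
  rw [abs_mul]
  exact mul_le_mul (hCg _) (hCh _) (abs_nonneg _) ((abs_nonneg _).trans (hCg (y u)))

/-- **THE EXACT THREE-TIME LAW OF THE COLD START.**  For bounded measurable `f, g, h` and all `s, u, v`:
`E_{x₀}[f(X_s)g(X_{s+u})h(X_{s+u+v})] = (1 − r^s)·E_π[f(X_0)g(X_u)h(X_{u+v})]
  + r^s f(x₀)·[(1 − r^u)·∫ g·(K^v h) dπ + r^u g(x₀)·((1 − r^v)·π h + r^v h(x₀))]`. [ours] -/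
theorem imh_chain_threeTime_mode [Fact (Measurable w)] (hw0 : ∀ y, 0 < w y) {x₀ : Ω} (hmax : ∀ y, w y ≤ w x₀)
    [IsProbabilityMeasure (q.withDensity fun y => ENNReal.ofReal (w y))]
    {f g h : Ω → ℝ} (hf : Measurable f) {Cf : ℝ} (hCf : ∀ x, |f x| ≤ Cf) (hg : Measurable g) {Cg : ℝ}
    (hCg : ∀ x, |g x| ≤ Cg) (hh : Measurable h) {Ch : ℝ} (hCh : ∀ x, |h x| ≤ Ch) (s u v : ℕ) :
    ∫ x, f (x s) * (g (x (s + u)) * h (x (s + (u + v))))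
        ∂(Kernel.trajMeasure (X := fun _ : ℕ => Ω) (Measure.dirac x₀)
          (fun n : ℕ => (indepMH q w).comap (fun h : (i : ↥(Finset.Iic n)) → Ω => h ⟨n, Finset.mem_Iic.2 le_rfl⟩)
            (measurable_pi_apply _))) =
      (1 - (1 - (w x₀)⁻¹) ^ s) *
          ∫ x, f (x 0) * (g (x u) * h (x (u + v))) ∂(Kernel.trajMeasure (X := fun _ : ℕ => Ω)
            (q.withDensity fun y => ENNReal.ofReal (w y))
            (fun n : ℕ => (indepMH q w).comap (fun h : (i : ↥(Finset.Iic n)) → Ω => h ⟨n, Finset.mem_Iic.2 le_rfl⟩)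
              (measurable_pi_apply _))) +
        (1 - (w x₀)⁻¹) ^ s * (f x₀ *
          ((1 - (1 - (w x₀)⁻¹) ^ u) *
              ∫ x, g x * (kop (indepMH q w))^[v] h x ∂(q.withDensity fun y => ENNReal.ofReal (w y)) +
            (1 - (w x₀)⁻¹) ^ u * (g x₀ *
              ((1 - (1 - (w x₀)⁻¹) ^ v) * ∫ x, h x ∂(q.withDensity fun y => ENNReal.ofReal (w y)) +
                (1 - (w x₀)⁻¹) ^ v * h x₀)))) := by
  obtain ⟨hGm, hGb⟩ := measurable_twoTime_statistic hg hCg hh hCh u v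
  rw [imh_chain_mul_shift_mode hw0 hmax hf hCf (F := fun y : ℕ → Ω => g (y u) * h (y (u + v))) hGm hGb s,
    imh_chain_twoTime_mode hw0 hmax hg hCg hh hCh u v]

/-- **Centred form** (`π h = 0`): `E_{x₀}[f(X_s)g(X_{s+u})h̄(X_{s+u+v})] = (1 − r^s)·E_π[f(X_0)g(X_u)h̄(X_{u+v})]
  + r^s(1 − r^u)·f(x₀)·∫ g·(K^v h̄) dπ + r^{s+u+v}·f(x₀)g(x₀)h̄(x₀)` — the last is the TRIPLY FROZEN term. [ours] -/
theorem imh_chain_threeTime_mode_of_centred [Fact (Measurable w)] (hw0 : ∀ y, 0 < w y) {x₀ : Ω}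
    (hmax : ∀ y, w y ≤ w x₀) [IsProbabilityMeasure (q.withDensity fun y => ENNReal.ofReal (w y))]
    {f g h : Ω → ℝ} (hf : Measurable f) {Cf : ℝ} (hCf : ∀ x, |f x| ≤ Cf) (hg : Measurable g) {Cg : ℝ}
    (hCg : ∀ x, |g x| ≤ Cg) (hh : Measurable h) {Ch : ℝ} (hCh : ∀ x, |h x| ≤ Ch)
    (hh0 : ∫ x, h x ∂(q.withDensity fun y => ENNReal.ofReal (w y)) = 0) (s u v : ℕ) :
    ∫ x, f (x s) * (g (x (s + u)) * h (x (s + (u + v))))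
        ∂(Kernel.trajMeasure (X := fun _ : ℕ => Ω) (Measure.dirac x₀)
          (fun n : ℕ => (indepMH q w).comap (fun h : (i : ↥(Finset.Iic n)) → Ω => h ⟨n, Finset.mem_Iic.2 le_rfl⟩)
            (measurable_pi_apply _))) =
      (1 - (1 - (w x₀)⁻¹) ^ s) *
          ∫ x, f (x 0) * (g (x u) * h (x (u + v))) ∂(Kernel.trajMeasure (X := fun _ : ℕ => Ω)
            (q.withDensity fun y => ENNReal.ofReal (w y))
            (fun n : ℕ => (indepMH q w).comap (fun h : (i : ↥(Finset.Iic n)) → Ω => h ⟨n, Finset.mem_Iic.2 le_rfl⟩)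
              (measurable_pi_apply _))) +
        (1 - (w x₀)⁻¹) ^ s * (1 - (1 - (w x₀)⁻¹) ^ u) * (f x₀ *
          ∫ x, g x * (kop (indepMH q w))^[v] h x ∂(q.withDensity fun y => ENNReal.ofReal (w y))) +
        (1 - (w x₀)⁻¹) ^ (s + u + v) * (f x₀ * g x₀ * h x₀) := by
  rw [imh_chain_threeTime_mode hw0 hmax hf hCf hg hCg hh hCh s u v, hh0, mul_zero, zero_add, pow_add, pow_add]
  ring

/-- **AGAINST THE EQUILIBRIUM RUN**: `E_{x₀}[f(X_s)g(X_{s+u})h(X_{s+u+v})] − E_π[f(X_s)g(X_{s+u})h(X_{s+u+v})]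
  = r^s·(f(x₀)·E_{x₀}[g(X_u)h(X_{u+v})] − E_π[f(X_0)g(X_u)h(X_{u+v})])`. [ours] -/
theorem imh_chain_threeTime_mode_sub_stationary [Fact (Measurable w)] (hw0 : ∀ y, 0 < w y) {x₀ : Ω}
    (hmax : ∀ y, w y ≤ w x₀) [IsProbabilityMeasure (q.withDensity fun y => ENNReal.ofReal (w y))]
    {f g h : Ω → ℝ} (hf : Measurable f) {Cf : ℝ} (hCf : ∀ x, |f x| ≤ Cf) (hg : Measurable g) {Cg : ℝ}
    (hCg : ∀ x, |g x| ≤ Cg) (hh : Measurable h) {Ch : ℝ} (hCh : ∀ x, |h x| ≤ Ch) (s u v : ℕ) :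
    ∫ x, f (x s) * (g (x (s + u)) * h (x (s + (u + v))))
        ∂(Kernel.trajMeasure (X := fun _ : ℕ => Ω) (Measure.dirac x₀)
          (fun n : ℕ => (indepMH q w).comap (fun h : (i : ↥(Finset.Iic n)) → Ω => h ⟨n, Finset.mem_Iic.2 le_rfl⟩)
            (measurable_pi_apply _))) -
      ∫ x, f (x s) * (g (x (s + u)) * h (x (s + (u + v))))
        ∂(Kernel.trajMeasure (X := fun _ : ℕ => Ω) (q.withDensity fun y => ENNReal.ofReal (w y))
          (fun n : ℕ => (indepMH q w).comap (fun h : (i : ↥(Finset.Iic n)) → Ω => h ⟨n, Finset.mem_Iic.2 le_rfl⟩)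
            (measurable_pi_apply _))) =
      (1 - (w x₀)⁻¹) ^ s *
        (f x₀ * ∫ x, g (x u) * h (x (u + v)) ∂(Kernel.trajMeasure (X := fun _ : ℕ => Ω) (Measure.dirac x₀)
            (fun n : ℕ => (indepMH q w).comap (fun h : (i : ↥(Finset.Iic n)) → Ω => h ⟨n, Finset.mem_Iic.2 le_rfl⟩)
              (measurable_pi_apply _))) -
          ∫ x, f (x 0) * (g (x u) * h (x (u + v))) ∂(Kernel.trajMeasure (X := fun _ : ℕ => Ω)
            (q.withDensity fun y => ENNReal.ofReal (w y))
            (fun n : ℕ => (indepMH q w).comap (fun h : (i : ↥(Finset.Iic n)) → Ω => h ⟨n, Finset.mem_Iic.2 le_rfl⟩)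
              (measurable_pi_apply _)))) := by
  obtain ⟨hGm, hGb⟩ := measurable_twoTime_statistic hg hCg hh hCh u v
  exact imh_chain_mul_shift_mode_sub_stationary hw0 hmax hf hCf (F := fun y : ℕ → Ω => g (y u) * h (y (u + v)))
    hGm hGb s

end Summit.Ventures.LatticeQCDFlow.Exactness
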